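import Mathlib
import Summits.ResolutionOfSingularities.ResolutionOfSingularities.Theses.HomologicalConductor
import Summits.ResolutionOfSingularities.ResolutionOfSingularities.Theorems.HomologicalConductorPersistenceLevel
import HarnessLib

/-!
# Crux `Persistence` (stmt-ResolutionOfSingularities-16484) — persistence with a LEVEL SHIFT (repair of the levelled
# vocabulary after tri-2's TRIAGE v4 row I1-5; res-L1-w44b-plan-1 ORDER w44b-o2)

[OURS · L1 w44b; AI-written and AI-reviewed only (weaker than expert review); NOT a statement of the manuscript under
study (Hironaka 2017), and no statement of that manuscript is used here.]

`Theorems/HomologicalConductorPersistenceLevel.lean` (res-L1-w44b-idea-1, p495549) fixed `LevelPersistence n`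
(`caⁿ(T_m) ⊆ caⁿ(T_(m+1))` for every `m`) and `persistence_of_forall_levelPersistence : (∀ n, LevelPersistence n) →
Persistence`. The chain's own negative bench `LevelFourPersistenceFails = ¬ LevelPersistence 4` (numerical evidence,
idea-1 N10/N11) makes the hypothesis `∀ n, LevelPersistence n` of that implication the WRONG reduction target (it is
refuted-on-evidence, so the implication is vacuous in use — tri-2 TRIAGE v4). The content of the chain is a level SHIFT
(two-step transfer, exponent two: `…PersistenceTwoStepTransferExponentTwo`), so this module records the honest reductions:

* `LevelPersistenceShift s` — along the crux's canonical tower (binders and `let`s VERBATIM those of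
  `Theses.HomologicalConductor.Persistence` / `PersistenceLevel.LevelPersistence`), `caⁿ(T_m) ⊆ caⁿ⁺ˢ(T_(m+1))` for all
  `n`, `m` (a UNIFORM shift `s`);
* `persistence_of_levelPersistenceShift : LevelPersistenceShift s → Persistence` (`ca = ⋃ₙ caⁿ`);
* `persistence_of_forall_exists_level` — the POINTWISE form: if for every `m`, `n` there is SOME level `n'` with
  `caⁿ(T_m) ⊆ caⁿ'(T_(m+1))`, then `Persistence` (no uniformity in `m` or `n` needed);
* `levelPersistenceShift_zero_iff` — `LevelPersistenceShift 0 ↔ ∀ n, LevelPersistence n` (the old target is the shift-`0`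
  case), and `levelPersistenceShift_mono` — a shift `s` gives every larger shift.
-/

set_option linter.dupNamespace false

namespace Summit.ResolutionOfSingularities.ResolutionOfSingularities.Theorems.HomologicalConductor.PersistenceLevelShift

open Summit.ResolutionOfSingularities.ResolutionOfSingularities.Theorems.HomologicalConductor.PersistenceLevel

/-- [OURS · L1 w44b · ORDER w44b-o2 / tri-2 TRIAGE v4 I1-5] PERSISTENCE WITH A UNIFORM LEVEL SHIFT `s`: along the crux's
canonical tower `T_m → T_(m+1) = loc (nrm (chart T_m))` (binders and `let`s verbatim those of
`Theses.HomologicalConductor.Persistence`; the chart is cut out by the full `ca`), for every level `n` and every stage `m`,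
`caⁿ(T_m) ⊆ caⁿ⁺ˢ(T_(m+1))`. NOT a statement of the manuscript. -/
def LevelPersistenceShift (s : ℕ) : Prop :=
  ∀ p : ℕ, p.Prime → ∀ (k K : Type) [Field k] [CharP k p] [Field K] [Algebra k K] (O : ValuationSubring K) (A : Subalgebra k K), (∀ c : k, algebraMap k K c ∈ O) → A.FG → IsFractionRing ↥A K → A.toSubring ≤ O.toSubring → let caAt : ℕ → Subalgebra k K → Set K := fun n A => {x : K | ∃ hx : x ∈ A, ∀ i : ℕ, n ≤ i → ∀ (M N : ModuleCat.{0} ↥A), Module.Finite ↥A M → Module.Finite ↥A N → ∀ e : CategoryTheory.Abelian.Ext.{0} M N i, (⟨x, hx⟩ : ↥A) • e = 0}; let ca : Subalgebra k K → Set K := fun A => {x : K | ∃ hx : x ∈ A, ∃ n : ℕ, ∀ i : ℕ, n ≤ i → ∀ (M N : ModuleCat.{0} ↥A), Module.Finite ↥A M → Module.Finite ↥A N → ∀ e : CategoryTheory.Abelian.Ext.{0} M N i, (⟨x, hx⟩ : ↥A) • e = 0}; let loc : Subalgebra k K → Subalgebra k K := fun A => Algebra.adjoin k {y : K | ∃ a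 ∈ A, ∃ s ∈ A, s⁻¹ ∈ O ∧ y = a * s⁻¹}; let chart : Subalgebra k K → Subalgebra k K := fun A => Algebra.adjoin k ((A : Set K) ∪ {y : K | ∃ c ∈ ca A, ∃ x ∈ ca A, x ≠ 0 ∧ (∀ c' ∈ ca A, c' * x⁻¹ ∈ O) ∧ y = c * x⁻¹}); let nrm : Subalgebra k K → Subalgebra k K := fun B => Algebra.adjoin k {y : K | IsIntegral ↥B y}; let tower : Subalgebra k K → ℕ → Subalgebra k K := fun A m => @Nat.rec (fun _ => Subalgebra k K) (loc A) (fun _ B => loc (nrm (chart B))) m; ∀ n m : ℕ, caAt n (tower A m) ⊆ caAt (n + s) (tower A (m + 1))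

/-- `ca = ⋃ₙ caⁿ`: persistence with a uniform level shift `s` implies the crux `Persistence`. [folklore] -/
theorem persistence_of_levelPersistenceShift (s : ℕ) (h : LevelPersistenceShift s) :
    Summit.ResolutionOfSingularities.ResolutionOfSingularities.Theses.HomologicalConductor.Persistence := by
  intro p hp k K _ _ _ _ O A hk hA hfr hAO ca loc chart nrm tower m x hx
  obtain ⟨hxA, n, hn⟩ := hx
  have hstep := h p hp k K O A hk hA hfr hAO n m
  obtain ⟨hx', h'⟩ := hstep ⟨hxA, hn⟩
  exact ⟨hx', n + s, h'⟩

/-- **The pointwise form**: if along the canonical tower every element of `caⁿ(T_m)` lies in SOME `caⁿ'(T_(m+1))` — here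
stated one containment per pair `(m, n)`, the level `n'` free to depend on `m` and `n` — then the crux `Persistence`
holds (`ca = ⋃ₙ caⁿ`; no uniformity is needed for this direction). Binders and `let`s verbatim those of
`Theses.HomologicalConductor.Persistence`. [folklore] -/
theorem persistence_of_forall_exists_level
    (h : ∀ p : ℕ, p.Prime → ∀ (k K : Type) [Field k] [CharP k p] [Field K] [Algebra k K] (O : ValuationSubring K) (A : Subalgebra k K), (∀ c : k, algebraMap k K c ∈ O) → A.FG → IsFractionRing ↥A K → A.toSubring ≤ O.toSubring → let caAt : ℕ → Subalgebra k K → Set K := fun n A => {x : K | ∃ hx : x ∈ A, ∀ i : ℕ, n ≤ i → ∀ (M N : ModuleCat.{0} ↥A), Module.Finite ↥A M → Module.Finite ↥A N → ∀ e : CategoryTheory.Abelian.Ext.{0} M N i, (⟨x, hx⟩ : ↥A) • e = 0}; let ca : Subalgebra k K → Set K := fun A => {x : K | ∃ hx : x ∈ A, ∃ n : ℕ, ∀ i : ℕ, n ≤ i → ∀ (M N : ModuleCat.{0} ↥A), Module.Finite ↥A M → Module.Finite ↥A N → ∀ e : CategoryTheory.Abelian.Ext.{0} M N i, (⟨x,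 hx⟩ : ↥A) • e = 0}; let loc : Subalgebra k K → Subalgebra k K := fun A => Algebra.adjoin k {y : K | ∃ a ∈ A, ∃ s ∈ A, s⁻¹ ∈ O ∧ y = a * s⁻¹}; let chart : Subalgebra k K → Subalgebra k K := fun A => Algebra.adjoin k ((A : Set K) ∪ {y : K | ∃ c ∈ ca A, ∃ x ∈ ca A, x ≠ 0 ∧ (∀ c' ∈ ca A, c' * x⁻¹ ∈ O) ∧ y = c * x⁻¹}); let nrm : Subalgebra k K → Subalgebra k K := fun B => Algebra.adjoin k {y : K | IsIntegral ↥B y}; let tower : Subalgebra k K → ℕ → Subalgebra k K := fun A m => @Nat.rec (fun _ => Subalgebra k K) (loc A) (fun _ B => loc (nrm (chart B))) m; ∀ m n : ℕ, ∃ n' : ℕ, caAt n (tower A m) ⊆ caAt n' (tower A (m + 1))) :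
    Summit.ResolutionOfSingularities.ResolutionOfSingularities.Theses.HomologicalConductor.Persistence := by
  intro p hp k K _ _ _ _ O A hk hA hfr hAO ca loc chart nrm tower m x hx
  obtain ⟨hxA, n, hn⟩ := hx
  obtain ⟨n', hstep⟩ := h p hp k K O A hk hA hfr hAO m n
  obtain ⟨hx', h'⟩ := hstep ⟨hxA, hn⟩
  exact ⟨hx', n', h'⟩

/-- The old reduction target is the shift-`0` case: `LevelPersistenceShift 0 ↔ ∀ n, LevelPersistence n`. [folklore] -/
theorem levelPersistenceShift_zero_iff : LevelPersistenceShift 0 ↔ ∀ n, LevelPersistence n := by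
  constructor
  · intro h n p hp k K _ _ _ _ O A hk hA hfr hAO caAt ca loc chart nrm tower m
    exact h p hp k K O A hk hA hfr hAO n m
  · intro h p hp k K _ _ _ _ O A hk hA hfr hAO caAt ca loc chart nrm tower n m
    exact h n p hp k K O A hk hA hfr hAO m

/-- A level shift `s` gives every larger shift `s'` (`caⁿ⁺ˢ ⊆ caⁿ⁺ˢ'` for `s ≤ s'`). [folklore] -/
theorem levelPersistenceShift_mono {s s' : ℕ} (hss' : s ≤ s') (h : LevelPersistenceShift s) :
    LevelPersistenceShift s' := by
  intro p hp k K _ _ _ _ O A hk hA hfr hAO caAt ca loc chart nrm tower n m x hx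
  obtain ⟨hx', h'⟩ := h p hp k K O A hk hA hfr hAO n m hx
  exact ⟨hx', fun i hi => h' i (by omega)⟩

/-- Hence a uniform level shift is a special case of the pointwise form (sanity link between the two reductions).
[folklore] -/
theorem persistence_of_levelPersistenceShift' (s : ℕ) (h : LevelPersistenceShift s) :
    Summit.ResolutionOfSingularities.ResolutionOfSingularities.Theses.HomologicalConductor.Persistence :=
  persistence_of_forall_exists_level fun p hp k K _ _ _ _ O A hk hA hfr hAO m n =>
    ⟨n + s, h p hp k K O A hk hA hfr hAO n m⟩

end Summit.ResolutionOfSingularities.ResolutionOfSingularities.Theorems.HomologicalConductor.PersistenceLevelShift
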